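import Mathlib
import Literature.LinearAlgebra.Matrix.PosSemidefTrace
import Literature.Probability.RandomMatrix.TwoQubitSeparabilityVolumesQubitFibreProofs
import HarnessLib

/-!
# The two-pole (`2 × 2`) semidefinite certificate, I: the pencil toolkit

FILE SPLIT (400-line rule): part I of the master file `TwoPoleCertificateClosedForm.lean` (pub-hubbard
cell, seat `pseudo` g64, staged beside this file): the `TwoPoleCertificate` toolkit — real symmetric
`2 × 2` matrices `symTwo`, the minors criterion, the moment matrix `M(ρ)` and its inverse, one-line weak
duality, the pencil invariants `τ, Δ, D, e±`, `certValue`, and the positivity of the two pencils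
`e₊ M⁻¹ - C`, `C - e₋ M⁻¹`. Part II (`HubbardTwoPoleCertificate`) proves the closed form and its
optimality. The body below is byte-identical to the master; the master overview follows verbatim.
FILER NOTE (lit g34, 2026-08-26): thirteen one-line `/-- … -/` docstrings were added to auxiliary lemmas for the
gate's docstring-on-every-declaration rule; no statement, proof or definition byte was changed.

# Closed form of the two-pole (`2 × 2`) semidefinite certificate

HONEST FRAMING (page 1): ladder R1–R4 with certified numbers; no claim on H/H₀; first certified
bounds; not a superconductivity verdict. This file is a lemma about a `2 × 2` semidefinite
programme; it claims nothing about the Hubbard model beyond the bound it is combined with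
(pub-hubbard cell, seat `pseudo` g64, `PSEUDO.md` §110 / `TO-ENG.md` §C 130; staged, NOT filed —
the FILER decision is the desk's). FILE LAYOUT: this master file (> 500 lines) exceeds the gate's
400-line cap for proof-carrying `Summits` files; the filer-ready split into
`HubbardTwoPolePencil` (part I = the `TwoPoleCertificate` toolkit up to the positivity of the two
pencils) and `HubbardTwoPoleCertificate` (part II = the optimal certificate, weak duality and the
literal-matrix specialisation) is staged beside it with byte-identical bodies.

Context. The certificate-form two-pole lower bound (`hubbardTorus_groundEnergyAt_ge_twoPole`,
staged separately as `HubbardTwoPoleBound.lean`, pseudo g63; split `HubbardTwoPoleFrame` +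
`HubbardTwoPoleBound` by lit g33) bounds the ground-state energy of the Hubbard torus at filling
`2n` from below by `-(∑_σ (∑_k Re tr(T_σk · M(ρ)) + μ_σ n))`, `ρ = n / L^d`, for ANY family of
`2 × 2` matrices `T_σk ⪰ 0` with `C_σk + T_σk ⪰ 0`, where
`C = !![ε + μ, λ/2; λ/2, U/2 - λ]` is the cost matrix of the mode and `M(ρ) = !![1, ρ; ρ, ρ]` the
moment (Gram) matrix of the two poles. The optimisation over each `T_σk` — a `2 × 2` semidefinite
programme — was left untyped there. This file solves it in closed form, for real `a b d` and
`0 < ρ < 1` (`C = symTwo a b d = !![a, b; b, d]`, `M = symTwo 1 ρ ρ`):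

* with `τ := a + 2ρ b + ρ d = tr(C M)` (`pencilTrace`), `Δ := (a d - b²) ρ (1 - ρ) = det(C M)`
  (`pencilDet`), `D := τ² - 4Δ` (`pencilDisc`; a sum of two squares, `pencilDisc_eq_sq_add_sq`)
  and `e± := (τ ± √D)/2` (`rootHi`, `rootLo`: the two real eigenvalues of `C M`, i.e. the
  generalized eigenvalues of the pencil `C - t M⁻¹`), the optimal value is
  `sup {-Re tr(T M) : T ⪰ 0, C + T ⪰ 0} = min 0 e₊ + min 0 e₋ =: certValue a b d ρ`
  (`isGreatest_certValue`);
* the supremum is ATTAINED (`exists_certificate`) by the explicit certificate `T⋆ = 0` if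
  `e₋ ≥ 0`, `T⋆ = -C` if `e₊ ≤ 0`, and the rank-one `T⋆ = (-e₋/√D) · (e₊ M⁻¹ - C)` if
  `e₋ < 0 < e₊` (then `C + T⋆ = (e₊/√D) · (C - e₋ M⁻¹)`), where
  `M⁻¹ = !![1/(1-ρ), -1/(1-ρ); -1/(1-ρ), 1/(ρ(1-ρ))]` and both `e₊ M⁻¹ - C` (`pencil … e₊`) and
  `C - e₋ M⁻¹` are positive semidefinite of determinant zero (`posSemidef_pencil_rootHi`,
  `posSemidef_neg_pencil_rootLo`);
* weak duality (`neg_re_trace_mul_le_certValue`): no admissible `T` does better — primal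
  witnesses `G = 0`, `G = M`, `G = M (e₊ M⁻¹ - C) Mᴴ / √D` with `0 ⪯ G ⪯ M` and
  `Re tr(C G) = certValue` (`neg_re_trace_mul_le_of_primal` is the one-line weak duality
  `-Re tr(T M) ≤ Re tr(C G)`);
* the specialisation `a = ε + μ`, `b = λ/2`, `d = U/2 - λ` written with the LITERAL matrices of
  the two-pole bound (`exists_twoPole_certificate`, `twoPole_certificate_optimal`), so that the two
  files combine by `rfl` on the matrices: choosing `T σ k` by `exists_twoPole_certificate` turns the
  certificate-form bound into the closed form
  `e₀(2n) ≥ ∑_σ (∑_k certValue (ε_k + μ_σ) (λ_σ/2) (U/2 - λ_σ) ρ - μ_σ n)`, and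
  `twoPole_certificate_optimal` says no other choice of the `T σ k` gives more.

Method: every matrix is a real symmetric `2 × 2` matrix `symTwo x y z`; positivity is decided by
the `2 × 2` minors criterion (cited from
`Literature.Probability.RandomMatrix.ZhangJiangXie2025.posSemidef_fin_two_iff'`), congruence
`M X Mᴴ` and traces are computed entrywise (`gram_mul_symTwo_mul_gram`, `trace_symTwo_mul_symTwo`),
and everything else is real algebra: `(r - e₋)(r - e₊) = r² - τ r + Δ`, the bracketings
`e₋ ≤ a(1-ρ) ≤ e₊`, `e₋ ≤ d ρ(1-ρ) ≤ e₊` (from `f(a(1-ρ)) = -ρ(1-ρ)(a+b)² ≤ 0`,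
`f(dρ(1-ρ)) = -ρ(1-ρ)(b+ρd)² ≤ 0`), and `det(t M⁻¹ - C) = f(t)/(ρ(1-ρ))`.
Elementary; [folklore] (strong duality for a `2 × 2` semidefinite programme, made explicit).
All statements are PROVED (no placeholders, no named facts); no new axioms, no instances, no notation.
-/

noncomputable section

open Matrix
open scoped ComplexOrder ComplexConjugate Matrix

namespace Summit.HubbardSuperconductivity.HubbardLadder

namespace TwoPoleCertificate

/-! ## Real symmetric `2 × 2` matrices as complex matrices -/

/-- The real symmetric matrix `!![x, y; y, z]`, as a complex `2 × 2` matrix. -/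
def symTwo (x y z : ℝ) : Matrix (Fin 2) (Fin 2) ℂ := !![(x : ℂ), (y : ℂ); (y : ℂ), (z : ℂ)]

/-- `symTwo` is additive: `!![x, y; y, z] + !![x', y'; y', z'] = !![x + x', y + y'; y + y', z + z']`. -/
theorem symTwo_add (x y z x' y' z' : ℝ) :
    symTwo x y z + symTwo x' y' z' = symTwo (x + x') (y + y') (z + z') := by
  ext i j
  fin_cases i <;> fin_cases j <;> simp [symTwo]

/-- `symTwo` respects subtraction, entrywise. -/
theorem symTwo_sub (x y z x' y' z' : ℝ) :
    symTwo x y z - symTwo x' y' z' = symTwo (x - x') (y - y') (z - z') := by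
  ext i j
  fin_cases i <;> fin_cases j <;> simp [symTwo]

/-- `-!![x, y; y, z] = !![-x, -y; -y, -z]`. -/
theorem neg_symTwo (x y z : ℝ) : -symTwo x y z = symTwo (-x) (-y) (-z) := by
  ext i j
  fin_cases i <;> fin_cases j <;> simp [symTwo]

/-- `symTwo 0 0 0` is the zero matrix. -/
theorem symTwo_zero : symTwo 0 0 0 = 0 := by
  ext i j
  fin_cases i <;> fin_cases j <;> simp [symTwo]

/-- `symTwo x y z` is Hermitian (real symmetric): `(symTwo x y z)ᴴ = symTwo x y z`. -/
theorem conjTranspose_symTwo (x y z : ℝ) : (symTwo x y z)ᴴ = symTwo x y z := by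
  ext i j
  fin_cases i <;> fin_cases j <;> simp [symTwo, Matrix.conjTranspose_apply]

/-- `tr(!![a, b; b, d] · !![x, y; y, z]) = a x + 2 b y + d z`. -/
theorem trace_symTwo_mul_symTwo (a b d x y z : ℝ) :
    (symTwo a b d * symTwo x y z).trace = ((a * x + 2 * (b * y) + d * z : ℝ) : ℂ) := by
  have h00 : (symTwo a b d * symTwo x y z) 0 0 = a * x + b * y := by
    simp [symTwo, Matrix.mul_apply, Fin.sum_univ_two]
  have h11 : (symTwo a b d * symTwo x y z) 1 1 = b * y + d * z := by
    simp [symTwo, Matrix.mul_apply, Fin.sum_univ_two]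
  rw [Matrix.trace_fin_two, h00, h11]
  push_cast
  ring

/-- The congruence `M X Mᴴ` by the moment matrix `M = !![1, ρ; ρ, ρ]`, entrywise. -/
theorem gram_mul_symTwo_mul_gram (ρ x y z : ℝ) :
    symTwo 1 ρ ρ * symTwo x y z * (symTwo 1 ρ ρ)ᴴ =
      symTwo (x + 2 * ρ * y + ρ ^ 2 * z) (ρ * (x + y + ρ * y + ρ * z))
        (ρ ^ 2 * (x + 2 * y + z)) := by
  rw [conjTranspose_symTwo]
  ext i j
  fin_cases i <;> fin_cases j <;> simp [symTwo, Matrix.mul_apply, Fin.sum_univ_two] <;> ring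

/-- **`2 × 2` minors criterion** for `symTwo x y z = !![x, y; y, z]`: positive semidefinite iff
`0 ≤ x`, `0 ≤ z` and `y² ≤ x z` (the Hermitian criterion
`ZhangJiangXie2025.posSemidef_fin_two_iff'` with a real off-diagonal entry). -/
theorem posSemidef_symTwo_iff (x y z : ℝ) :
    (symTwo x y z).PosSemidef ↔ 0 ≤ x ∧ 0 ≤ z ∧ y ^ 2 ≤ x * z := by
  have h := Literature.Probability.RandomMatrix.ZhangJiangXie2025.posSemidef_fin_two_iff'
    x z (y : ℂ)
  rw [Complex.conj_ofReal, Complex.normSq_ofReal, ← sq] at h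
  exact h

/-- Scaling the entries of a positive semidefinite `symTwo` by `c ≥ 0` keeps it positive
semidefinite. -/
theorem posSemidef_symTwo_scale {c x y z : ℝ} (hc : 0 ≤ c) (h : (symTwo x y z).PosSemidef) :
    (symTwo (c * x) (c * y) (c * z)).PosSemidef := by
  rw [posSemidef_symTwo_iff] at h ⊢
  obtain ⟨hx, hz, hyz⟩ := h
  refine ⟨mul_nonneg hc hx, mul_nonneg hc hz, ?_⟩
  have h2 : c ^ 2 * y ^ 2 ≤ c ^ 2 * (x * z) := mul_le_mul_of_nonneg_left hyz (sq_nonneg c)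
  calc (c * y) ^ 2 = c ^ 2 * y ^ 2 := by ring
    _ ≤ c ^ 2 * (x * z) := h2
    _ = c * x * (c * z) := by ring

/-- The moment matrix `M(ρ) = !![1, ρ; ρ, ρ]` is positive semidefinite for `0 ≤ ρ ≤ 1`. -/
theorem posSemidef_gram {ρ : ℝ} (h0 : 0 ≤ ρ) (h1 : ρ ≤ 1) : (symTwo 1 ρ ρ).PosSemidef := by
  rw [posSemidef_symTwo_iff]
  refine ⟨zero_le_one, h0, ?_⟩
  nlinarith [mul_nonneg h0 (sub_nonneg.mpr h1)]

/-- The inverse moment matrix `M(ρ)⁻¹ = !![1/(1-ρ), -1/(1-ρ); -1/(1-ρ), 1/(ρ(1-ρ))]` is positive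
semidefinite for `0 < ρ < 1`. -/
theorem posSemidef_gramInv {ρ : ℝ} (h0 : 0 < ρ) (h1 : ρ < 1) :
    (symTwo (1 / (1 - ρ)) (-(1 / (1 - ρ))) (1 / (ρ * (1 - ρ)))).PosSemidef := by
  have h1' : 0 < 1 - ρ := by linarith
  have hm : 0 < ρ * (1 - ρ) := mul_pos h0 h1'
  rw [posSemidef_symTwo_iff]
  refine ⟨(one_div_pos.mpr h1').le, (one_div_pos.mpr hm).le, ?_⟩
  have key : 1 / (1 - ρ) ^ 2 ≤ 1 / ((1 - ρ) * (ρ * (1 - ρ))) :=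
    one_div_le_one_div_of_le (mul_pos h1' hm)
      (by nlinarith [mul_nonneg (sq_nonneg (1 - ρ)) h1'.le])
  have hne : (1 : ℝ) - ρ ≠ 0 := h1'.ne'
  have hρ : ρ ≠ 0 := h0.ne'
  calc (-(1 / (1 - ρ))) ^ 2 = 1 / (1 - ρ) ^ 2 := by field_simp
    _ ≤ 1 / ((1 - ρ) * (ρ * (1 - ρ))) := key
    _ = 1 / (1 - ρ) * (1 / (ρ * (1 - ρ))) := by rw [one_div_mul_one_div]

/-- **Weak duality** (any size): if `T ⪰ 0`, `C + T ⪰ 0` and `0 ⪯ G ⪯ M`, then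
`-Re tr(T M) ≤ Re tr(C G)`. [folklore] -/
theorem neg_re_trace_mul_le_of_primal {n : Type*} [Fintype n] [DecidableEq n]
    {C T M G : Matrix n n ℂ} (hT : T.PosSemidef) (hCT : (C + T).PosSemidef)
    (hG : G.PosSemidef) (hMG : (M - G).PosSemidef) :
    -((T * M).trace).re ≤ ((C * G).trace).re := by
  have h1 := Literature.LinearAlgebra.Matrix.re_trace_mul_nonneg_of_posSemidef hCT hG
  have h2 := Literature.LinearAlgebra.Matrix.re_trace_mul_nonneg_of_posSemidef hT hMG
  rw [add_mul, trace_add, Complex.add_re] at h1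
  rw [mul_sub, trace_sub, Complex.sub_re] at h2
  linarith

/-! ## The pencil invariants and the closed-form value -/

/-- `τ = tr(C M)` for `C = !![a, b; b, d]`, `M = !![1, ρ; ρ, ρ]`. -/
def pencilTrace (a b d ρ : ℝ) : ℝ := a + 2 * ρ * b + ρ * d

/-- `Δ = det(C M) = det C · det M`. -/
def pencilDet (a b d ρ : ℝ) : ℝ := (a * d - b ^ 2) * (ρ * (1 - ρ))

/-- The discriminant `D = τ² - 4Δ` of the characteristic polynomial `t² - τ t + Δ` of `C M`. -/
def pencilDisc (a b d ρ : ℝ) : ℝ := pencilTrace a b d ρ ^ 2 - 4 * pencilDet a b d ρ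

/-- The larger eigenvalue `e₊ = (τ + √D)/2` of `C M`. -/
def rootHi (a b d ρ : ℝ) : ℝ := (pencilTrace a b d ρ + Real.sqrt (pencilDisc a b d ρ)) / 2

/-- The smaller eigenvalue `e₋ = (τ - √D)/2` of `C M`. -/
def rootLo (a b d ρ : ℝ) : ℝ := (pencilTrace a b d ρ - Real.sqrt (pencilDisc a b d ρ)) / 2

/-- The closed-form value `min 0 e₊ + min 0 e₋` of the certificate programme
`sup {-Re tr(T M) : T ⪰ 0, C + T ⪰ 0}` (sum of the negative eigenvalues of `C M`). -/
def certValue (a b d ρ : ℝ) : ℝ := min 0 (rootHi a b d ρ) + min 0 (rootLo a b d ρ)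

/-- `t · M(ρ)⁻¹ - C`, written out:
`!![t/(1-ρ) - a, -t/(1-ρ) - b; -t/(1-ρ) - b, t/(ρ(1-ρ)) - d]`. -/
def pencil (a b d ρ t : ℝ) : Matrix (Fin 2) (Fin 2) ℂ :=
  symTwo (t / (1 - ρ) - a) (-(t / (1 - ρ)) - b) (t / (ρ * (1 - ρ)) - d)

/-- `τ = Re tr(C · M(ρ))` for `C = symTwo a b d`, `M(ρ) = symTwo 1 ρ ρ`. -/
theorem pencilTrace_eq_re_trace (a b d ρ : ℝ) :
    ((symTwo a b d * symTwo 1 ρ ρ).trace).re = pencilTrace a b d ρ := by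
  rw [trace_symTwo_mul_symTwo, Complex.ofReal_re, pencilTrace]
  ring

/-- `D = (a + 2ρb + ρ(2ρ-1)d)² + 4ρ(1-ρ)(b + ρd)²`. -/
theorem pencilDisc_eq_sq_add_sq (a b d ρ : ℝ) :
    pencilDisc a b d ρ =
      (a + 2 * ρ * b + ρ * (2 * ρ - 1) * d) ^ 2 + 4 * (ρ * (1 - ρ)) * (b + ρ * d) ^ 2 := by
  simp only [pencilDisc, pencilTrace, pencilDet]
  ring

/-- The discriminant `D` is nonnegative for `0 ≤ ρ ≤ 1` (a sum of two squares). -/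
theorem pencilDisc_nonneg (a b d : ℝ) {ρ : ℝ} (h0 : 0 ≤ ρ) (h1 : ρ ≤ 1) :
    0 ≤ pencilDisc a b d ρ := by
  rw [pencilDisc_eq_sq_add_sq]
  have hm : 0 ≤ ρ * (1 - ρ) := mul_nonneg h0 (sub_nonneg.mpr h1)
  nlinarith [sq_nonneg (a + 2 * ρ * b + ρ * (2 * ρ - 1) * d), mul_nonneg hm (sq_nonneg (b + ρ * d))]

/-- Vieta: `e₊ + e₋ = τ`. -/
theorem rootHi_add_rootLo (a b d ρ : ℝ) :
    rootHi a b d ρ + rootLo a b d ρ = pencilTrace a b d ρ := by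
  simp only [rootHi, rootLo]
  ring

/-- `e₊ - e₋ = √D`. -/
theorem rootHi_sub_rootLo (a b d ρ : ℝ) :
    rootHi a b d ρ - rootLo a b d ρ = Real.sqrt (pencilDisc a b d ρ) := by
  simp only [rootHi, rootLo]
  ring

/-- `e₋ ≤ e₊`. -/
theorem rootLo_le_rootHi (a b d ρ : ℝ) : rootLo a b d ρ ≤ rootHi a b d ρ := by
  have := Real.sqrt_nonneg (pencilDisc a b d ρ)
  simp only [rootHi, rootLo]
  linarith

/-- Vieta: `e₊ · e₋ = Δ` (for `0 ≤ ρ ≤ 1`, where `√D² = D`). -/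
theorem rootHi_mul_rootLo (a b d : ℝ) {ρ : ℝ} (h0 : 0 ≤ ρ) (h1 : ρ ≤ 1) :
    rootHi a b d ρ * rootLo a b d ρ = pencilDet a b d ρ := by
  have hD : Real.sqrt (pencilDisc a b d ρ) ^ 2 = pencilTrace a b d ρ ^ 2 - 4 * pencilDet a b d ρ := by
    rw [Real.sq_sqrt (pencilDisc_nonneg a b d h0 h1), pencilDisc]
  simp only [rootHi, rootLo]
  linear_combination (-1 / 4 : ℝ) * hD

/-- `(r - e₋)(r - e₊) = r² - τ r + Δ`. -/
theorem sub_rootLo_mul_sub_rootHi (a b d : ℝ) {ρ : ℝ} (h0 : 0 ≤ ρ) (h1 : ρ ≤ 1) (r : ℝ) :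
    (r - rootLo a b d ρ) * (r - rootHi a b d ρ) =
      r ^ 2 - pencilTrace a b d ρ * r + pencilDet a b d ρ := by
  have hs := rootHi_add_rootLo a b d ρ
  have hp := rootHi_mul_rootLo a b d h0 h1
  linear_combination (-r) * hs + hp

/-- `e₊` is a root of `r² - τ r + Δ`. -/
theorem rootHi_isRoot (a b d : ℝ) {ρ : ℝ} (h0 : 0 ≤ ρ) (h1 : ρ ≤ 1) :
    rootHi a b d ρ ^ 2 - pencilTrace a b d ρ * rootHi a b d ρ + pencilDet a b d ρ = 0 := by
  rw [← sub_rootLo_mul_sub_rootHi a b d h0 h1]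
  ring

/-- `e₋` is a root of `r² - τ r + Δ`. -/
theorem rootLo_isRoot (a b d : ℝ) {ρ : ℝ} (h0 : 0 ≤ ρ) (h1 : ρ ≤ 1) :
    rootLo a b d ρ ^ 2 - pencilTrace a b d ρ * rootLo a b d ρ + pencilDet a b d ρ = 0 := by
  rw [← sub_rootLo_mul_sub_rootHi a b d h0 h1]
  ring

/-- A real `r` with `r² - τ r + Δ ≤ 0` lies between the two roots. -/
theorem rootLo_le_le_rootHi (a b d : ℝ) {ρ : ℝ} (h0 : 0 ≤ ρ) (h1 : ρ ≤ 1) {r : ℝ}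
    (hr : r ^ 2 - pencilTrace a b d ρ * r + pencilDet a b d ρ ≤ 0) :
    rootLo a b d ρ ≤ r ∧ r ≤ rootHi a b d ρ := by
  rw [← sub_rootLo_mul_sub_rootHi a b d h0 h1 r] at hr
  have hle := rootLo_le_rootHi a b d ρ
  by_contra h
  rw [not_and_or, not_le, not_le] at h
  rcases h with h | h
  · have : 0 < (r - rootLo a b d ρ) * (r - rootHi a b d ρ) :=
      mul_pos_of_neg_of_neg (by linarith) (by linarith)
    linarith
  · have : 0 < (r - rootLo a b d ρ) * (r - rootHi a b d ρ) := mul_pos (by linarith) (by linarith)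
    linarith

/-- `f(a(1-ρ)) = -ρ(1-ρ)(a+b)²` for `f(t) = t² - τ t + Δ`. -/
theorem charPoly_at_diag₀ (a b d ρ : ℝ) :
    (a * (1 - ρ)) ^ 2 - pencilTrace a b d ρ * (a * (1 - ρ)) + pencilDet a b d ρ =
      -(ρ * (1 - ρ)) * (a + b) ^ 2 := by
  simp only [pencilTrace, pencilDet]
  ring

/-- `f(dρ(1-ρ)) = -ρ(1-ρ)(b+ρd)²`. -/
theorem charPoly_at_diag₁ (a b d ρ : ℝ) :
    (d * (ρ * (1 - ρ))) ^ 2 - pencilTrace a b d ρ * (d * (ρ * (1 - ρ))) + pencilDet a b d ρ =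
      -(ρ * (1 - ρ)) * (b + ρ * d) ^ 2 := by
  simp only [pencilTrace, pencilDet]
  ring

/-- `e₋ ≤ a(1-ρ) ≤ e₊`. -/
theorem roots_bracket_diag₀ (a b d : ℝ) {ρ : ℝ} (h0 : 0 ≤ ρ) (h1 : ρ ≤ 1) :
    rootLo a b d ρ ≤ a * (1 - ρ) ∧ a * (1 - ρ) ≤ rootHi a b d ρ := by
  refine rootLo_le_le_rootHi a b d h0 h1 ?_
  rw [charPoly_at_diag₀]
  nlinarith [mul_nonneg (mul_nonneg h0 (sub_nonneg.mpr h1)) (sq_nonneg (a + b))]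

/-- `e₋ ≤ dρ(1-ρ) ≤ e₊`. -/
theorem roots_bracket_diag₁ (a b d : ℝ) {ρ : ℝ} (h0 : 0 ≤ ρ) (h1 : ρ ≤ 1) :
    rootLo a b d ρ ≤ d * (ρ * (1 - ρ)) ∧ d * (ρ * (1 - ρ)) ≤ rootHi a b d ρ := by
  refine rootLo_le_le_rootHi a b d h0 h1 ?_
  rw [charPoly_at_diag₁]
  nlinarith [mul_nonneg (mul_nonneg h0 (sub_nonneg.mpr h1)) (sq_nonneg (b + ρ * d))]

/-- `det(t M⁻¹ - C) · ρ(1-ρ) = f(t)`: the `2 × 2` minor of `pencil a b d ρ t`. -/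
theorem pencil_minor (a b d t : ℝ) {ρ : ℝ} (h0 : 0 < ρ) (h1 : ρ < 1) :
    (t / (1 - ρ) - a) * (t / (ρ * (1 - ρ)) - d) - (-(t / (1 - ρ)) - b) ^ 2 =
      (t ^ 2 - pencilTrace a b d ρ * t + pencilDet a b d ρ) / (ρ * (1 - ρ)) := by
  have hρ : ρ ≠ 0 := h0.ne'
  have h1' : (1 : ℝ) - ρ ≠ 0 := by intro h; linarith
  simp only [pencilTrace, pencilDet]
  field_simp
  ring

/-- `P₊ := e₊ M⁻¹ - C ⪰ 0` (determinant zero, nonnegative diagonal). -/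
theorem posSemidef_pencil_rootHi (a b d : ℝ) {ρ : ℝ} (h0 : 0 < ρ) (h1 : ρ < 1) :
    (pencil a b d ρ (rootHi a b d ρ)).PosSemidef := by
  have h1' : 0 < 1 - ρ := by linarith
  have hm : 0 < ρ * (1 - ρ) := mul_pos h0 h1'
  obtain ⟨-, hr0⟩ := roots_bracket_diag₀ a b d h0.le h1.le
  obtain ⟨-, hr1⟩ := roots_bracket_diag₁ a b d h0.le h1.le
  rw [pencil, posSemidef_symTwo_iff]
  refine ⟨?_, ?_, ?_⟩
  · rw [sub_nonneg, le_div_iff₀ h1']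
    exact hr0
  · rw [sub_nonneg, le_div_iff₀ hm]
    exact hr1
  · have key := pencil_minor a b d (rootHi a b d ρ) h0 h1
    rw [rootHi_isRoot a b d h0.le h1.le, zero_div] at key
    linarith

/-- `P₋ := C - e₋ M⁻¹ ⪰ 0` (determinant zero, nonnegative diagonal). -/
theorem posSemidef_neg_pencil_rootLo (a b d : ℝ) {ρ : ℝ} (h0 : 0 < ρ) (h1 : ρ < 1) :
    (-pencil a b d ρ (rootLo a b d ρ)).PosSemidef := by
  have h1' : 0 < 1 - ρ := by linarith
  have hm : 0 < ρ * (1 - ρ) := mul_pos h0 h1'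
  obtain ⟨hr0, -⟩ := roots_bracket_diag₀ a b d h0.le h1.le
  obtain ⟨hr1, -⟩ := roots_bracket_diag₁ a b d h0.le h1.le
  rw [pencil, neg_symTwo, posSemidef_symTwo_iff]
  refine ⟨?_, ?_, ?_⟩
  · rw [neg_sub, sub_nonneg, div_le_iff₀ h1']
    exact hr0
  · rw [neg_sub, sub_nonneg, div_le_iff₀ hm]
    exact hr1
  · have key := pencil_minor a b d (rootLo a b d ρ) h0 h1
    rw [rootLo_isRoot a b d h0.le h1.le, zero_div] at key
    nlinarith [key]

end TwoPoleCertificate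

end Summit.HubbardSuperconductivity.HubbardLadder
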